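import Literature.Analysis.PDE.LoewnerNirenbergBoundaryAsymptotics
import Literature.Analysis.PDE.LoewnerNirenbergFactsProofs
import HarnessLib

/-!
# The maximal solution of the exterior of a ball (F1 proved for exteriors of closed balls)

The third model case of the maximal-solution fact
`Literature.Analysis.PDE.LoewnerNirenberg.exists_isMaximalSolution` (F1 of
`LoewnerNirenbergFacts.lean`), PROVED with no named fact: for `n ≥ 3`, `R > 0`, on
`Ω = ℝⁿ ∖ B̄(c,R)` the exterior Poincaré profile `v_{R,c}(x) = (2R/(|x-c|² - R²))^{(n-2)/2}`
(Han–Shen 2020, (2.2); González–Li–Nguyen 2018, §2.3, `u^{(out)}_{R,x₀}`) is the MAXIMAL solution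
of `Δu = ¼n(n-2)u^{(n+2)/(n-2)}`:

* `IsSubsolution.le_rpow_of_mem_compl_closedBall` — the a-priori decay
  `u(y) ≤ (4/(|y-c| - R))^{(n-2)/2}` of every (sub)solution on the exterior (Lemma 3.1 of
  González–Li–Nguyen 2018 on the ball `B̄(y, (|y-c|-R)/2) ⊆ Ω`), in particular `u → 0` at
  infinity;
* `IsSolution.le_exteriorProfile` — every solution `u` on `Ω` lies below `v_{R,c}`: for
  `R < R' < |x-c|`, `u ≤ v_{R',c}` on `ℝⁿ ∖ B̄(c,R')` by the comparison principle for two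
  solutions with compact positive superlevel sets (`IsSolution.le_of_isCompact_superlevel`:
  `u - v_{R'}` tends to `-∞` at the sphere `|y-c| = R'`, where `u` is continuous and
  `v_{R'} = +∞`, and `(u - v_{R'})⁺ → 0` at infinity by the decay of `u`), then `R' ↓ R`
  (the proof of González–Li–Nguyen 2018, Lemma 2.3, run on the exterior; the role of the removable
  isolated singularity of the inverted picture is played by the decay at infinity);
* hence `isMaximalSolution_exteriorProfile` (F1 for exteriors of balls),
  `exists_isMaximalSolution_compl_closedBall`, and **LN4 (exterior of a ball), unconditional**:
  `u_{ℝⁿ ∖ B̄(c,R)} = (2R/(|x-c|² - R²))^{(n-2)/2}` (`loewnerNirenberg_compl_closedBall_eqOn`) — the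
  value recorded as missing in the design notes of `LoewnerNirenbergFacts.lean`;
* `IsLargeSolution.eqOn_exteriorProfile` — uniqueness of the large solution of the exterior
  (every large solution dominates `v_{R'',c}`, `R'' < R`, by `IsLargeSolution.exteriorProfile_le`,
  and `R'' ↑ R`).

## References

* M. d. M. González, Y. Y. Li, L. Nguyen, *Existence and uniqueness to a fully nonlinear version
  of the Loewner–Nirenberg problem*, Commun. Math. Stat. 6 (2018) 269–288, arXiv:1804.08851:
  §2.3, Lemma 2.3 (proof), Lemma 3.1, Def. 4.1. [GonzalezLiNguyen2018]
* Q. Han, W. Shen, *The Loewner–Nirenberg problem in singular domains*, J. Funct. Anal. 279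
  (2020) 108604, arXiv:1511.01146: (2.2). [HanShen2020]
-/

noncomputable section

open Set Filter Metric Module TopologicalSpace Bornology
open scoped Laplacian Topology ContDiff

namespace Literature.Analysis.PDE

namespace LoewnerNirenberg

variable {E : Type*} [NormedAddCommGroup E] [InnerProductSpace ℝ E] [FiniteDimensional ℝ E]

section Exterior

variable {c x : E} {R : ℝ} {u : E → ℝ}

omit [InnerProductSpace ℝ E] [FiniteDimensional ℝ E] in
/-- Half-way balls stay in the exterior: `B̄(y, (|y-c|-R)/2) ⊆ ℝⁿ ∖ B̄(c,R)` for `|y - c| > R`.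
[folklore] -/
theorem closedBall_half_subset_compl_closedBall [NormedSpace ℝ E] {y : E}
    (hy : y ∈ (closedBall c R)ᶜ) : closedBall y ((‖y - c‖ - R) / 2) ⊆ (closedBall c R)ᶜ := by
  rw [mem_compl_iff, mem_closedBall, dist_eq_norm, not_le] at hy
  intro z hz
  rw [mem_closedBall, dist_eq_norm] at hz
  rw [mem_compl_iff, mem_closedBall, dist_eq_norm, not_le]
  have h1 : ‖y - c‖ - ‖y - z‖ ≤ ‖z - c‖ := by
    have := norm_sub_norm_le (y - c) (y - z)
    rwa [show y - c - (y - z) = z - c by abel] at this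
  rw [norm_sub_rev] at hz
  linarith

/-- **A-priori decay on the exterior of a ball** (González–Li–Nguyen 2018, Lemma 3.1, on the ball
`B̄(y, (|y-c|-R)/2) ⊆ ℝⁿ ∖ B̄(c,R)`): a subsolution on `ℝⁿ ∖ B̄(c,R)`, `n ≥ 3`, satisfies
`u(y) ≤ (4/(|y-c| - R))^{(n-2)/2}` for `|y-c| > R`; in particular `u → 0` at infinity.
[cite: GonzalezLiNguyen2018, Lemma 3.1] -/
theorem IsSubsolution.le_rpow_of_mem_compl_closedBall (hn : 3 ≤ finrank ℝ E)
    (hu : IsSubsolution (closedBall c R)ᶜ u) {y : E} (hy : y ∈ (closedBall c R)ᶜ) :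
    u y ≤ (4 / (‖y - c‖ - R)) ^ (((finrank ℝ E : ℝ) - 2) / 2) := by
  have hyR : R < ‖y - c‖ := by
    rwa [mem_compl_iff, mem_closedBall, dist_eq_norm, not_le] at hy
  have hr : 0 < (‖y - c‖ - R) / 2 := by linarith
  have h := hu.le_rpow_of_closedBall_subset hn isClosed_closedBall.isOpen_compl hr
    (closedBall_half_subset_compl_closedBall hy)
  have heq : 2 / ((‖y - c‖ - R) / 2) = 4 / (‖y - c‖ - R) := by
    rw [div_div_eq_mul_div]
    ring
  rwa [heq] at h

omit [InnerProductSpace ℝ E] [FiniteDimensional ℝ E] in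
/-- The decay profile `(4/(|y-c| - R))^k`, `k > 0`, tends to `0` at infinity. [folklore] -/
theorem tendsto_decayProfile_cobounded [NormedSpace ℝ E] (c : E) (R : ℝ) {k : ℝ} (hk : 0 < k) :
    Tendsto (fun y : E => (4 / (‖y - c‖ - R)) ^ k) (cobounded E) (𝓝 0) := by
  have h1 : Tendsto (fun y : E => ‖y - c‖) (cobounded E) atTop := by
    refine tendsto_atTop_mono (fun y => ?_)
      (tendsto_atTop_add_const_right _ (-‖c‖) tendsto_norm_cobounded_atTop)
    have := norm_sub_norm_le y c
    linarith
  have h2 : Tendsto (fun y : E => ‖y - c‖ - R) (cobounded E) atTop :=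
    (tendsto_atTop_add_const_right _ (-R) h1).congr fun y => by ring
  have h3 : Tendsto (fun y : E => 4 / (‖y - c‖ - R)) (cobounded E) (𝓝 0) :=
    tendsto_const_nhds.div_atTop h2
  have h4 := h3.rpow_const (p := k) (Or.inr hk.le)
  rwa [Real.zero_rpow hk.ne'] at h4

/-- **Every solution on the exterior of a ball lies below the exterior profile** (`n ≥ 3`,
`R > 0`): a solution `u` on `ℝⁿ ∖ B̄(c,R)` satisfies `u ≤ v_{R,c} = (2R/(|x-c|² - R²))^{(n-2)/2}`
there. For `R < R' < |x - c|`, `u ≤ v_{R',c}` on `ℝⁿ ∖ B̄(c,R')` by the comparison of two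
solutions whose difference has compact positive superlevel sets
(`IsSolution.le_of_isCompact_superlevel`): `u - v_{R'} → -∞` at the sphere `|y-c| = R'` (`u` is
continuous there, `v_{R'} = +∞`) and `u → 0` at infinity
(`IsSubsolution.le_rpow_of_mem_compl_closedBall`); then `R' ↓ R` (González–Li–Nguyen 2018, proof
of Lemma 2.3, on the exterior). [cite: GonzalezLiNguyen2018, Lemma 2.3 (proof) and Lemma 3.1] -/
theorem IsSolution.le_exteriorProfile (hn : 3 ≤ finrank ℝ E) (hR : 0 < R)
    (hu : IsSolution (closedBall c R)ᶜ u) (hx : x ∈ (closedBall c R)ᶜ) :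
    u x ≤ exteriorProfile c R x := by
  obtain ⟨k, hk⟩ : ∃ k : ℝ, ((finrank ℝ E : ℝ) - 2) / 2 = k := ⟨_, rfl⟩
  have hk0 : 0 < k := by
    have : (3 : ℝ) ≤ finrank ℝ E := by exact_mod_cast hn
    rw [← hk]; linarith
  have hxR : R < ‖x - c‖ := by
    rwa [mem_compl_iff, mem_closedBall, dist_eq_norm, not_le] at hx
  -- the a-priori decay of `u`
  have hKO : ∀ y ∈ (closedBall c R)ᶜ, u y ≤ (4 / (‖y - c‖ - R)) ^ k := fun y hy => by
    have := hu.isSubsolution.le_rpow_of_mem_compl_closedBall hn hy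
    rwa [hk] at this
  -- comparison with `v_{R'}` on `ℝⁿ ∖ B̄(c,R')`, `R < R' < |x - c|`
  have key : ∀ R' ∈ Ioo R ‖x - c‖, u x ≤ exteriorProfile c R' x := by
    intro R' hR'
    have hR'0 : 0 < R' := hR.trans hR'.1
    have hΩ'o : IsOpen (closedBall c R')ᶜ := isClosed_closedBall.isOpen_compl
    have hΩ'Ω : (closedBall c R')ᶜ ⊆ (closedBall c R)ᶜ :=
      compl_subset_compl.2 (closedBall_subset_closedBall hR'.1.le)
    have hxΩ' : x ∈ (closedBall c R')ᶜ := by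
      rw [mem_compl_iff, mem_closedBall, dist_eq_norm, not_le]
      exact hR'.2
    have hu' : IsSolution (closedBall c R')ᶜ u := hu.mono hΩ'Ω
    have hv : IsSolution (closedBall c R')ᶜ (exteriorProfile c R') :=
      isSolution_exteriorProfile c hR'0
    refine hu'.le_of_isCompact_superlevel hn hΩ'o hv (fun s hs => ?_) x hxΩ'
    refine Metric.isCompact_of_isClosed_isBounded ?_ ?_
    · refine isClosed_superlevel_of_tendsto_atBot hΩ'o
        (hu'.contDiffOn.continuousOn.sub hv.contDiffOn.continuousOn) (fun z hz => ?_) s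
      -- at the sphere `|z - c| = R'`: `u` is continuous, `v_{R'} → +∞`
      have hzR : z ∈ (closedBall c R)ᶜ := by
        have hz' := hz
        rw [frontier_compl, frontier_closedBall c hR'0.ne', mem_sphere, dist_eq_norm] at hz'
        rw [mem_compl_iff, mem_closedBall, dist_eq_norm, not_le, hz']
        exact hR'.1
      have h1 : Tendsto u (𝓝[(closedBall c R')ᶜ] z) (𝓝 (u z)) :=
        ((hu.contDiffOn.continuousOn.continuousAt
          (isClosed_closedBall.isOpen_compl.mem_nhds hzR)).tendsto).mono_left nhdsWithin_le_nhds
      have h2 : Tendsto (fun y => -exteriorProfile c R' y) (𝓝[(closedBall c R')ᶜ] z) atBot :=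
        tendsto_neg_atTop_atBot.comp (tendsto_exteriorProfile_atTop hn c hR'0 hz)
      exact (h1.add_atBot h2).congr fun y => (sub_eq_add_neg (u y) (exteriorProfile c R' y)).symm
    · -- bounded: on the superlevel set `s ≤ u - v_{R'} ≤ u ≤ (4/(|y-c|-R))^k`
      have hb : {y : E | (4 / (‖y - c‖ - R)) ^ k < s} ∈ cobounded E :=
        (tendsto_decayProfile_cobounded c R hk0).eventually (gt_mem_nhds hs)
      have hB : IsBounded {y : E | s ≤ (4 / (‖y - c‖ - R)) ^ k} := by
        rw [isBounded_def]
        exact Filter.mem_of_superset hb fun y hy => by simpa [not_le] using hy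
      refine hB.subset fun y hy => ?_
      have h0 : 0 ≤ exteriorProfile c R' y := (exteriorProfile_pos hR'0 hy.1).le
      have h1 : s ≤ u y - exteriorProfile c R' y := hy.2
      exact h1.trans ((sub_le_self _ h0).trans (hKO y (hΩ'Ω hy.1)))
  -- `R' ↓ R`
  have htend : Tendsto (fun σ : ℝ => exteriorProfile c σ x) (𝓝[>] R) (𝓝 (exteriorProfile c R x)) :=
    (continuousAt_exteriorProfile_radius c x hR hxR).tendsto.mono_left nhdsWithin_le_nhds
  exact ge_of_tendsto htend (by filter_upwards [Ioo_mem_nhdsGT hxR] with R' hR' using key R' hR')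

/-- **F1 for exteriors of balls, PROVED**: for `n ≥ 3` and `R > 0` the exterior Poincaré profile
`v_{R,c}` is the maximal solution of `ℝⁿ ∖ B̄(c,R)` (González–Li–Nguyen 2018, §2.3 and Def. 4.1).
[cite: GonzalezLiNguyen2018, §2.3 and Def. 4.1] -/
theorem isMaximalSolution_exteriorProfile (hn : 3 ≤ finrank ℝ E) (c : E) (hR : 0 < R) :
    IsMaximalSolution (closedBall c R)ᶜ (exteriorProfile c R) where
  toIsSolution := isSolution_exteriorProfile c hR
  le := fun _ hv _ hx => hv.le_exteriorProfile hn hR hx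

/-- `exists_isMaximalSolution` for exteriors of balls: `ℝⁿ ∖ B̄(c,R)`, `R > 0`, `n ≥ 3`, carries
a positive maximal solution. [cite: GonzalezLiNguyen2018, §2.3 and Def. 4.1] -/
theorem exists_isMaximalSolution_compl_closedBall (hn : 3 ≤ finrank ℝ E) (c : E) (hR : 0 < R) :
    ∃ u : E → ℝ, IsMaximalSolution (closedBall c R)ᶜ u ∧ ∀ x ∈ (closedBall c R)ᶜ, 0 < u x :=
  ⟨_, isMaximalSolution_exteriorProfile hn c hR, fun _ hx => exteriorProfile_pos hR hx⟩

/-- **LN4 (exterior of a ball), unconditional**: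
`u_{ℝⁿ ∖ B̄(c,R)}(x) = (2R/(|x-c|² - R²))^{(n-2)/2}` on `ℝⁿ ∖ B̄(c,R)`, `R > 0`, `n ≥ 3` (the
maximal solution; Han–Shen 2020, (2.2) for the profile). [cite: HanShen2020, (2.2)] -/
theorem loewnerNirenberg_compl_closedBall_eqOn (hn : 3 ≤ finrank ℝ E) (c : E) (hR : 0 < R) :
    EqOn (loewnerNirenberg (closedBall c R)ᶜ) (exteriorProfile c R) (closedBall c R)ᶜ :=
  (isMaximalSolution_exteriorProfile hn c hR).eqOn_loewnerNirenberg

/-- **A large solution of the exterior of a ball dominates the exterior profile** (`n ≥ 3`,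
`R > 0`): `v_{R'',c} ≤ u` for `R'' < R` (`IsLargeSolution.exteriorProfile_le`: the closure
`ℝⁿ ∖ B(c,R)` of the exterior misses `B̄(c,R'')`), and `R'' ↑ R`. [cite: HanShen2020, (2.2)] -/
theorem IsLargeSolution.exteriorProfile_le_of_compl_closedBall (hn : 3 ≤ finrank ℝ E)
    (hR : 0 < R) (hu : IsLargeSolution (closedBall c R)ᶜ u) (hx : x ∈ (closedBall c R)ᶜ) :
    exteriorProfile c R x ≤ u x := by
  have hxR : R < ‖x - c‖ := by
    rwa [mem_compl_iff, mem_closedBall, dist_eq_norm, not_le] at hx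
  have hcl : closure (closedBall c R)ᶜ = (ball c R)ᶜ := by
    rw [closure_compl, interior_closedBall c hR.ne']
  have key : ∀ R'' ∈ Ioo (R / 2) R, exteriorProfile c R'' x ≤ u x := fun R'' hR'' => by
    have hR''0 : 0 < R'' := (half_pos hR).trans hR''.1
    refine hu.exteriorProfile_le hn isClosed_closedBall.isOpen_compl hR''0 ?_ x hx
    rw [hcl]
    exact compl_subset_compl.2 (closedBall_subset_ball hR''.2)
  have htend : Tendsto (fun σ : ℝ => exteriorProfile c σ x) (𝓝[<] R) (𝓝 (exteriorProfile c R x)) :=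
    (continuousAt_exteriorProfile_radius c x hR hxR).tendsto.mono_left nhdsWithin_le_nhds
  exact le_of_tendsto htend
    (by filter_upwards [Ioo_mem_nhdsLT (half_lt_self hR)] with σ hσ using key σ hσ)

/-- **Uniqueness of the large solution of the exterior of a ball** (`n ≥ 3`, `R > 0`): every
solution on `ℝⁿ ∖ B̄(c,R)` with `u = ∞` on the sphere equals `(2R/(|x-c|² - R²))^{(n-2)/2}` — with
no condition at infinity. [cite: HanShen2020, (2.2)] -/
theorem IsLargeSolution.eqOn_exteriorProfile (hn : 3 ≤ finrank ℝ E) (hR : 0 < R)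
    (hu : IsLargeSolution (closedBall c R)ᶜ u) : EqOn u (exteriorProfile c R) (closedBall c R)ᶜ :=
  fun _ hx => le_antisymm (hu.toIsSolution.le_exteriorProfile hn hR hx)
    (hu.exteriorProfile_le_of_compl_closedBall hn hR hx)

end Exterior

end LoewnerNirenberg

end Literature.Analysis.PDE
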